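import Mathlib
import Summits.NavierStokesRegularity.NavierStokesRegularity.Theorems.DssFarFieldSlavingBlowupTypeIDssProfileGaussianSignCoherentSlice
import Literature.Analysis.FluidPDE.CurlFreeLiouville
import HarnessLib

/-!
# E33 in PERIOD-MEAN form (E33-MEAN, the census's operational ghost criterion n21) at profile level
  (pub-ns-dss theory T42 / row E33, NULL-TESTS n21 «sign of ∫ρ(y·U)Π», DERIVED ×2 red; route
  `DssFarFieldSlaving`, crux `BlowupTypeIDssProfile`, stmt-NavierStokesRegularity-0155 — SUPPORT; cell
  pub-ns-dss, typer seat g5, 2026-08-23; imports `…GaussianSignCoherentSlice.lean`)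

HONEST FRAMING. Nothing here is a statement about Navier–Stokes regularity or blow-up; an empty cell
is a census ghost index, never a discard. This file re-proves the landed profile-level E33 lemma
`GaussianHeadPressure.signCoherent_rdssProfile_trivial_slicePressure` with its POINTWISE sign hypothesis
`0 ≤ ⟪y, U⟫(½|U|² + P)` (all `y, s`) replaced by the single PERIOD-MEAN inequality
`0 ≤ ∫₀ˢ ∫ γ(y) ⟪y, U(y,s)⟫ Π(y,s) dy ds`, `γ(y) = e^{−|y|²/4}`, `Π = ½|U|² + P + ½⟪y, U⟫`
(`headPressure ½`), `S` the period — which is exactly what the proof reads: by the tree identity (E_G)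
(`gaussianHeadPressure_slice_poly`) `Z(s) + T(s) = −½ G(s)` slice by slice (`Z` = Gaussian enstrophy,
`T` = the time-derivative pairing whose period integral vanishes, `G(s) = ∫γ⟪y,U⟫Π`), so
`∫₀ˢ Z = −½ ∫₀ˢ G ≤ 0`, hence `curl U ≡ 0` and `U ≡ 0` as before. The pointwise form implies the mean
form (`⟪y,U⟫Π = ⟪y,U⟫(½|U|² + P) + ½⟪y,U⟫² ≥ 0`). The mean form is the one a certified numerical row
can instantiate (an integral with a sign), whereas a pointwise sign is certifiable only under exact sign
structure (theory g6 operational note, NULL-TESTS n21). All other binders verbatim.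
[this file; theory T42/E33, NULL-TESTS n21 (E33-MEAN); typer]
-/

noncomputable section

set_option linter.dupNamespace false

namespace Summit.NavierStokesRegularity.NavierStokesRegularity.Theorems.GaussianHeadPressure

open Set Function Filter MeasureTheory InnerProductSpace intervalIntegral
open scoped RealInnerProductSpace Laplacian ContDiff Topology BigOperators
open Literature.Analysis Literature.Analysis.FluidPDE Literature.Analysis.FluidPDE.PineauVicol2026
open Summit.NavierStokesRegularity.NavierStokesRegularity.Theorems

/-- **E33-MEAN at PROFILE level (slice-wise pressure)** — the landed
`signCoherent_rdssProfile_trivial_slicePressure` with the pointwise sign hypothesis replaced by the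
period mean `0 ≤ ∫₀ˢ ∫ γ ⟪y, U⟫ Π` (`Π = headPressure ½ U P = ½|U|² + P + ½⟪y,U⟫`). Hypotheses otherwise
verbatim: jointly smooth `S`-periodic `U`, slice-wise smooth `P`, `(U, P)` solving Pineau–Vicol's rotated
profile system (1.14a) slice by slice (any `α`), `div U(·,s) = 0`, trace Poisson, `|U| ≤ C/(1+|y|)`,
`‖D_yU‖ ≤ C`, `|P| ≤ C(1+|y|)ᴺ`, `|∂_sU| ≤ C(1+|y|)ᴺ`, `‖∇_yP‖ ≤ C(1+|y|)ᴺ` ⇒ `U ≡ 0`. Under these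
bounds the integrand of the hypothesis is integrable for every `s`
(`integrable_gaussWeight_mul_inner_mul_headPressure`) and its slice integral is continuous in `s`, so the
hypothesis is never satisfied by a junk integral. [this file; theory T42/E33, NULL-TESTS n21 (E33-MEAN); typer] -/
theorem meanSignCoherent_rdssProfile_trivial_slicePressure {N : ℕ}
    {U : EuclideanSpace ℝ (Fin 3) → ℝ → EuclideanSpace ℝ (Fin 3)}
    {P : EuclideanSpace ℝ (Fin 3) → ℝ → ℝ} {α S C : ℝ} (hS : 0 < S)
    (hUj : ContDiff ℝ ∞ (fun q : EuclideanSpace ℝ (Fin 3) × ℝ => U q.1 q.2))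
    (hPsl : ∀ s, ContDiff ℝ ∞ fun z : EuclideanSpace ℝ (Fin 3) => P z s)
    (hperU : ∀ y s, U y (s + S) = U y s)
    (heq : ∀ s y, fderiv ℝ (fun σ => U y σ) s 1 +
        α • (rotGen (U y s) - fderiv ℝ (fun z => U z s) y (rotGen y)) +
        (1 / 2 : ℝ) • U y s + (1 / 2 : ℝ) • fderiv ℝ (fun z => U z s) y y -
        (Δ (fun z => U z s)) y + convect (fun z => U z s) (fun z => U z s) y +
        gradient (fun z => P z s) y = 0)
    (hdiv : ∀ s, VectorCalculus.IsDivFree fun z => U z s)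
    (hΔP : ∀ s y, ∑ l, pderiv l (pderiv l fun z => P z s) y =
      -∑ l, ∑ j, pderiv l (fun z => U z s j) y * pderiv j (fun z => U z s l) y)
    (hUb : ∀ s y, ‖U y s‖ ≤ C / (1 + ‖y‖)) (hDUb : ∀ s y, ‖fderiv ℝ (fun z => U z s) y‖ ≤ C)
    (hPb : ∀ s y, |P y s| ≤ C * (1 + ‖y‖) ^ N)
    (hUsb : ∀ s y, ‖fderiv ℝ (fun σ => U y σ) s 1‖ ≤ C * (1 + ‖y‖) ^ N)
    (hgPb : ∀ s y, ‖gradient (fun z => P z s) y‖ ≤ C * (1 + ‖y‖) ^ N)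
    (hmean : 0 ≤ ∫ s in (0 : ℝ)..S, ∫ y, gaussWeight y *
      (⟪y, U y s⟫ * headPressure (1 / 2) (fun z => U z s) (fun z => P z s) y)) :
    ∀ y s, U y s = 0 := by
  -- the joint field and the constant `C ≥ 0`
  set Uj : EuclideanSpace ℝ (Fin 3) × ℝ → EuclideanSpace ℝ (Fin 3) := fun q => U q.1 q.2 with hUj_def
  have hC : 0 ≤ C := (norm_nonneg _).trans (hDUb 0 0)
  have h1y : ∀ y : EuclideanSpace ℝ (Fin 3), (1 : ℝ) ≤ 1 + ‖y‖ := fun y => by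
    linarith [norm_nonneg y]
  -- smoothness of slices and time lines
  have hUsl : ∀ s, ContDiff ℝ ∞ (fun z => U z s) := fun s =>
    hUj.comp (contDiff_id.prodMk contDiff_const)
  have hUt : ∀ y, ContDiff ℝ ∞ (fun σ => U y σ) := fun y =>
    hUj.comp (contDiff_const.prodMk contDiff_id)
  have hUjd : Differentiable ℝ Uj := hUj.differentiable (by simp)
  have cDUj : Continuous (fderiv ℝ Uj) := hUj.continuous_fderiv (by simp)
  -- the time derivative and the slice derivative through the joint derivative
  have hUs_eq : ∀ y s, fderiv ℝ (fun σ => U y σ) s 1 =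
      fderiv ℝ Uj (y, s) ((0 : EuclideanSpace ℝ (Fin 3)), (1 : ℝ)) := by
    intro y s
    have h := ((hUjd (y, s)).hasFDerivAt.comp s (hasFDerivAt_prodMk_right (𝕜 := ℝ) y s))
    rw [show (fun σ => U y σ) = Uj ∘ fun σ => (y, σ) from rfl, h.fderiv]
    simp
  have hUy_eq : ∀ y s, fderiv ℝ (fun z => U z s) y =
      (fderiv ℝ Uj (y, s)).comp (ContinuousLinearMap.inl ℝ (EuclideanSpace ℝ (Fin 3)) ℝ) := by
    intro y s
    have h := ((hUjd (y, s)).hasFDerivAt.comp y (hasFDerivAt_prodMk_left (𝕜 := ℝ) y s))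
    rw [show (fun z => U z s) = Uj ∘ fun z => (z, s) from rfl, h.fderiv]
  have hUs_y : ∀ s, ContDiff ℝ 1 (fun y => fderiv ℝ (fun σ => U y σ) s 1) := by
    intro s
    have e : (fun y => fderiv ℝ (fun σ => U y σ) s 1) =
        fun y => fderiv ℝ Uj (y, s) ((0 : EuclideanSpace ℝ (Fin 3)), (1 : ℝ)) :=
      funext fun y => hUs_eq y s
    rw [e]
    exact ((hUj.fderiv_right (m := 1) (by norm_cast)).comp
      (contDiff_id.prodMk contDiff_const)).clm_apply contDiff_const
  -- slice bounds in the shape of (E_G)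
  have hUb' : ∀ s y, ‖U y s‖ ≤ C := fun s y => (hUb s y).trans (div_le_self hC (h1y y))
  have hPb' : ∀ s y, |P y s| ≤ C * (1 + ‖y‖) ^ N := hPb
  -- Gaussian enstrophy `Z` and the time-derivative pairing `T` of each slice
  set Z : ℝ → ℝ := fun s => ∫ y, gaussWeight y * ‖curl (fun z => U z s) y‖ ^ 2 with hZ_def
  set T : ℝ → ℝ := fun s =>
    ∫ y, gaussWeight y * ⟪U y s + (1 / 2 : ℝ) • y, fderiv ℝ (fun σ => U y σ) s 1⟫ with hT_def
  -- the Gaussian radial-flux pairing `G` and (E_G): `Z + T = −½ G` slice by slice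
  set G : ℝ → ℝ := fun s => ∫ y, gaussWeight y *
    (⟪y, U y s⟫ * headPressure (1 / 2) (fun z => U z s) (fun z => P z s) y) with hG_def
  have hZT : ∀ s, Z s + T s = -(1 / 2 : ℝ) * G s := by
    intro s
    have hid := gaussianHeadPressure_slice_poly (N := N)
      (Us := fun y => fderiv ℝ (fun σ => U y σ) s 1) (hUsl s) (hPsl s) (hUs_y s) (heq s) (hdiv s)
      (hΔP s) (hUb' s) (hDUb s) (hUsb s) (hPb' s) (hgPb s)
    have hZs : Z s = ∫ y, gaussWeight y * ‖curl (fun z => U z s) y‖ ^ 2 := rfl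
    have hTs : T s = ∫ y, gaussWeight y *
        ⟪U y s + (1 / 2 : ℝ) • y, fderiv ℝ (fun σ => U y σ) s 1⟫ := rfl
    have hGs : G s = ∫ y, gaussWeight y *
        (⟪y, U y s⟫ * headPressure (1 / 2) (fun z => U z s) (fun z => P z s) y) := rfl
    rw [hZs, hTs, hGs]
    exact hid
  -- pointwise bounds of the two integrands
  have hZb : ∀ s y, ‖gaussWeight y * ‖curl (fun z => U z s) y‖ ^ 2‖ ≤
      (‖curlCLM‖ * C) ^ 2 * gaussWeight y := by
    intro s y
    rw [Real.norm_eq_abs, abs_mul, abs_of_pos (gaussWeight_pos y), abs_of_nonneg (by positivity),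
      mul_comm]
    exact mul_le_mul_of_nonneg_right (rotationDefect_norm_curl_sq_le (hDUb s) y) (gaussWeight_pos y).le
  have hTb : ∀ s y, ‖gaussWeight y * ⟪U y s + (1 / 2 : ℝ) • y, fderiv ℝ (fun σ => U y σ) s 1⟫‖ ≤
      (C + 1) * C * (1 + ‖y‖) ^ (N + 1) * gaussWeight y := by
    intro s y
    rw [Real.norm_eq_abs, abs_mul, abs_of_pos (gaussWeight_pos y)]
    have h1 : |⟪U y s + (1 / 2 : ℝ) • y, fderiv ℝ (fun σ => U y σ) s 1⟫| ≤
        (C + 1) * (1 + ‖y‖) * (C * (1 + ‖y‖) ^ N) :=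
      (abs_real_inner_le_norm _ _).trans (mul_le_mul
        (rotationDefect_norm_drift_le (U := fun z => U z s) hC (hUb' s) y) (hUsb s y)
        (norm_nonneg _) (by positivity))
    calc gaussWeight y * |⟪U y s + (1 / 2 : ℝ) • y, fderiv ℝ (fun σ => U y σ) s 1⟫|
        ≤ gaussWeight y * ((C + 1) * (1 + ‖y‖) * (C * (1 + ‖y‖) ^ N)) :=
          mul_le_mul_of_nonneg_left h1 (gaussWeight_pos y).le
      _ = (C + 1) * C * (1 + ‖y‖) ^ (N + 1) * gaussWeight y := by ring
  have iZb : Integrable fun y : EuclideanSpace ℝ (Fin 3) => (‖curlCLM‖ * C) ^ 2 * gaussWeight y :=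
    integrable_gaussWeight.const_mul _
  have iTb : Integrable fun y : EuclideanSpace ℝ (Fin 3) =>
      (C + 1) * C * (1 + ‖y‖) ^ (N + 1) * gaussWeight y := by
    refine integrable_of_le_poly_gaussWeight (by fun_prop) (K := (C + 1) * C) (N := N + 1)
      fun y => ?_
    have hγ0 := (gaussWeight_pos y).le
    rw [Real.norm_eq_abs, abs_of_nonneg (by positivity)]
  -- continuity in `s` of the two integrands, pointwise in `y`
  have cZy : ∀ y, Continuous fun s => gaussWeight y * ‖curl (fun z => U z s) y‖ ^ 2 := by
    intro y
    have e : (fun s => curl (fun z => U z s) y) = fun s =>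
        curlCLM ((fderiv ℝ Uj (y, s)).comp
          (ContinuousLinearMap.inl ℝ (EuclideanSpace ℝ (Fin 3)) ℝ)) := by
      funext s
      rw [show curl (fun z => U z s) y = curlCLM (fderiv ℝ (fun z => U z s) y) from rfl, hUy_eq]
    have c1 : Continuous fun s => curl (fun z => U z s) y := by
      rw [e]
      exact curlCLM.continuous.comp
        (((cDUj.comp (continuous_const.prodMk continuous_id)).clm_comp continuous_const))
    exact continuous_const.mul ((continuous_norm.comp c1).pow 2)
  have cTy : ∀ y, Continuous fun s =>
      gaussWeight y * ⟪U y s + (1 / 2 : ℝ) • y, fderiv ℝ (fun σ => U y σ) s 1⟫ := by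
    intro y
    have c1 : Continuous fun s => U y s := (hUt y).continuous
    have c2 : Continuous fun s => fderiv ℝ (fun σ => U y σ) s 1 :=
      ((hUt y).continuous_fderiv (by simp)).clm_apply continuous_const
    exact continuous_const.mul ((c1.add continuous_const).inner c2)
  -- measurability in `y` of the two integrands, for each `s`
  have mZ : ∀ s, AEStronglyMeasurable (fun y => gaussWeight y * ‖curl (fun z => U z s) y‖ ^ 2)
      volume := fun s =>
    (continuous_gaussWeight.mul ((continuous_norm.comp
      (continuous_curl ((hUsl s).of_le (by norm_cast)))).pow 2)).aestronglyMeasurable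
  have mT : ∀ s, AEStronglyMeasurable (fun y =>
      gaussWeight y * ⟪U y s + (1 / 2 : ℝ) • y, fderiv ℝ (fun σ => U y σ) s 1⟫) volume := by
    intro s
    have c1 : Continuous fun y => U y s := (hUsl s).continuous
    have c2 : Continuous fun y => fderiv ℝ (fun σ => U y σ) s 1 := (hUs_y s).continuous
    have c3 : Continuous fun y : EuclideanSpace ℝ (Fin 3) => (1 / 2 : ℝ) • y := by fun_prop
    exact (continuous_gaussWeight.mul ((c1.add c3).inner c2)).aestronglyMeasurable
  -- `Z` and `T` are continuous (dominated convergence)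
  have cZ : Continuous Z :=
    continuous_of_dominated mZ (fun s => Eventually.of_forall (hZb s)) iZb
      (Eventually.of_forall cZy)
  have cT : Continuous T :=
    continuous_of_dominated mT (fun s => Eventually.of_forall (hTb s)) iTb
      (Eventually.of_forall cTy)
  -- the period integral of `T` vanishes
  have hT0 : ∫ s in (0 : ℝ)..S, T s = 0 := by
    refine intervalIntegral_integral_weight_mul_inner_deriv_eq_zero (μ := volume)
      (U := U) (Us := fun y s => fderiv ℝ (fun σ => U y σ) s 1) hS.le gaussWeight
      (fun y s => ((hUt y).differentiable (by simp) s).hasDerivAt)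
      (fun y => ((hUt y).continuous_fderiv (by simp)).clm_apply continuous_const)
      (fun y => (hUt y).continuous) (fun y => by simpa using hperU y 0) ?_
    -- joint integrability on `(0, S] × ℝ³`
    have e : (fun p : ℝ × EuclideanSpace ℝ (Fin 3) => gaussWeight p.2 *
        ⟪U p.2 p.1 + (1 / 2 : ℝ) • p.2, fderiv ℝ (fun σ => U p.2 σ) p.1 1⟫) =
        fun p => gaussWeight p.2 * ⟪Uj (p.2, p.1) + (1 / 2 : ℝ) • p.2,
          fderiv ℝ Uj (p.2, p.1) ((0 : EuclideanSpace ℝ (Fin 3)), (1 : ℝ))⟫ := by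
      funext p; rw [hUs_eq]
    have cI : Continuous fun p : ℝ × EuclideanSpace ℝ (Fin 3) => gaussWeight p.2 *
        ⟪U p.2 p.1 + (1 / 2 : ℝ) • p.2, fderiv ℝ (fun σ => U p.2 σ) p.1 1⟫ := by
      rw [e]
      have csw : Continuous fun p : ℝ × EuclideanSpace ℝ (Fin 3) => (p.2, p.1) :=
        continuous_snd.prodMk continuous_fst
      have cU2 : Continuous fun p : ℝ × EuclideanSpace ℝ (Fin 3) => Uj (p.2, p.1) :=
        hUj.continuous.comp csw
      have cy2 : Continuous fun p : ℝ × EuclideanSpace ℝ (Fin 3) => (1 / 2 : ℝ) • p.2 := by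
        fun_prop
      have cD2 : Continuous fun p : ℝ × EuclideanSpace ℝ (Fin 3) =>
          fderiv ℝ Uj (p.2, p.1) ((0 : EuclideanSpace ℝ (Fin 3)), (1 : ℝ)) :=
        (cDUj.comp csw).clm_apply continuous_const
      have cγ2 : Continuous fun p : ℝ × EuclideanSpace ℝ (Fin 3) => gaussWeight p.2 :=
        continuous_gaussWeight.comp continuous_snd
      exact cγ2.mul ((cU2.add cy2).inner cD2)
    have h1 : Integrable (fun _ : ℝ => (1 : ℝ)) (volume.restrict (Ioc 0 S)) :=
      (continuous_const.integrableOn_Icc (a := 0) (b := S)).mono_set Ioc_subset_Icc_self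
    refine Integrable.mono' (h1.mul_prod iTb) cI.aestronglyMeasurable (Eventually.of_forall fun p => ?_)
    rw [one_mul]
    exact hTb p.1 p.2
  -- hence `∫₀ˢ Z ≤ 0`, so `Z ≡ 0` on `[0, S]`
  have hZnn : ∀ s, 0 ≤ Z s := fun s =>
    integral_nonneg fun y => mul_nonneg (gaussWeight_pos y).le (by positivity)
  have hZint : ∫ s in (0 : ℝ)..S, Z s ≤ 0 := by
    have e1 : ∫ s in (0 : ℝ)..S, Z s =
        (∫ s in (0 : ℝ)..S, (Z s + T s)) - ∫ s in (0 : ℝ)..S, T s := by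
      rw [intervalIntegral.integral_add (cZ.intervalIntegrable _ _) (cT.intervalIntegrable _ _)]
      ring
    have e2 : (∫ s in (0 : ℝ)..S, (Z s + T s)) = -(1 / 2 : ℝ) * ∫ s in (0 : ℝ)..S, G s := by
      rw [← intervalIntegral.integral_const_mul]
      exact intervalIntegral.integral_congr fun s _ => hZT s
    have hG0 : 0 ≤ ∫ s in (0 : ℝ)..S, G s := hmean
    rw [e1, hT0, sub_zero, e2]
    linarith
  have hZ0 : ∀ s ∈ Icc (0 : ℝ) S, Z s = 0 := by
    intro s₀ hs₀
    by_contra hne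
    have hpos : 0 < ∫ s in (0 : ℝ)..S, Z s :=
      intervalIntegral.integral_pos hS cZ.continuousOn (fun s _ => hZnn s)
        ⟨s₀, hs₀, lt_of_le_of_ne (hZnn s₀) (Ne.symm hne)⟩
    linarith
  -- `Z(s) = 0` forces `curl U(·, s) ≡ 0`
  have hcurl0 : ∀ s ∈ Icc (0 : ℝ) S, ∀ y, curl (fun z => U z s) y = 0 := by
    intro s hs y
    have hint : Integrable fun y => gaussWeight y * ‖curl (fun z => U z s) y‖ ^ 2 :=
      iZb.mono' (mZ s) (Eventually.of_forall (hZb s))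
    have hae := (integral_eq_zero_iff_of_nonneg
      (fun y => mul_nonneg (gaussWeight_pos y).le (by positivity)) hint).mp (hZ0 s hs)
    have hcont : Continuous fun y => gaussWeight y * ‖curl (fun z => U z s) y‖ ^ 2 :=
      continuous_gaussWeight.mul ((continuous_norm.comp
        (continuous_curl ((hUsl s).of_le (by norm_cast)))).pow 2)
    have hfun := (hcont.ae_eq_iff_eq (μ := volume) continuous_const).mp hae
    have hy : gaussWeight y * ‖curl (fun z => U z s) y‖ ^ 2 = 0 := congrFun hfun y
    have h2 : ‖curl (fun z => U z s) y‖ ^ 2 = 0 :=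
      (mul_eq_zero.mp hy).resolve_left (gaussWeight_pos y).ne'
    exact norm_eq_zero.mp ((pow_eq_zero_iff two_ne_zero).mp h2)
  -- periodicity: every slice is a slice with `s ∈ [0, S)`
  have hcurl : ∀ s y, curl (fun z => U z s) y = 0 := by
    intro s y
    have hmem := toIcoMod_mem_Ico hS 0 s
    have hdec := toIcoMod_add_toIcoDiv_zsmul hS 0 s
    set s' := toIcoMod hS 0 s with hs'
    set n := toIcoDiv hS 0 s with hn
    have hfun : (fun z => U z s) = fun z => U z s' := by
      funext z
      have hp : Function.Periodic (fun σ => U z σ) S := fun σ => hperU z σ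
      rw [← hdec]
      exact hp.zsmul n s'
    rw [hfun]
    rw [zero_add] at hmem
    exact hcurl0 s' ⟨hmem.1, hmem.2.le⟩ y
  -- curl-free, divergence-free, bounded slices are constant; decay makes them vanish
  intro y s
  have hconst : ∀ z, U z s = U 0 s := fun z =>
    eq_of_curl_eq_zero_of_isDivFree_of_bounded ((hUsl s).of_le (by norm_cast)) (hcurl s) (hdiv s)
      (hUb' s) z 0
  exact eq_zero_of_const_of_decay (V := fun z => U z s) hconst (hUb s) y



/-- **The Gaussian radial-flux integrand is integrable** under the bounds of the profile lemmas
(`U`, `P` continuous, `|U| ≤ C`, `|P| ≤ C(1+|y|)ᴺ`): `y ↦ γ(y) ⟪y, U(y)⟫ Π(y)`,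
`Π = headPressure ½ U P`, is dominated by `C(C² + 2C)(1+|y|)^{N+2} γ(y)`. Consequently the period-mean
hypothesis of `meanSignCoherent_rdssProfile_trivial_slicePressure` is a genuine inequality between
honest integrals — never satisfied through a junk (non-integrable, hence `0`) Bochner integral: the
slice integrand is integrable for every `s`, and the slice integral `G(s)` equals `−2(Z(s) + T(s))` by
(E_G), a continuous function of `s`. [folklore] -/
theorem integrable_gaussWeight_mul_inner_mul_headPressure {N : ℕ}
    {U : EuclideanSpace ℝ (Fin 3) → EuclideanSpace ℝ (Fin 3)} {P : EuclideanSpace ℝ (Fin 3) → ℝ} {C : ℝ}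
    (hU : Continuous U) (hP : Continuous P) (hUb : ∀ y, ‖U y‖ ≤ C)
    (hPb : ∀ y, |P y| ≤ C * (1 + ‖y‖) ^ N) :
    Integrable fun y => gaussWeight y * (⟪y, U y⟫ * headPressure (1 / 2) U P y) := by
  have hC : 0 ≤ C := (norm_nonneg _).trans (hUb 0)
  have cI : Continuous fun y : EuclideanSpace ℝ (Fin 3) => ⟪y, U y⟫ := continuous_id.inner hU
  have cH : Continuous (headPressure (1 / 2) U P) := by
    have e : headPressure (1 / 2) U P = fun y => 2⁻¹ * ‖U y‖ ^ 2 + P y + 1 / 2 * ⟪y, U y⟫ :=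
      funext fun y => headPressure_apply _ _ _ _
    rw [e]
    exact ((continuous_const.mul (hU.norm.pow 2)).add hP).add (continuous_const.mul cI)
  refine integrable_of_le_poly_gaussWeight (continuous_gaussWeight.mul (cI.mul cH))
    (K := C * (C ^ 2 + C + C)) (N := N + 2) fun y => ?_
  have h1 : |⟪y, U y⟫| ≤ (1 + ‖y‖) * C :=
    (abs_real_inner_le_norm _ _).trans
      (mul_le_mul (by linarith [norm_nonneg y]) (hUb y) (norm_nonneg _) (by positivity))
  have h2 := abs_headPressure_le_poly hC hUb hPb y
  rw [norm_mul, norm_mul, Real.norm_of_nonneg (gaussWeight_pos y).le, Real.norm_eq_abs,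
    Real.norm_eq_abs]
  calc gaussWeight y * (|⟪y, U y⟫| * |headPressure (1 / 2) U P y|)
      ≤ gaussWeight y * (((1 + ‖y‖) * C) * ((C ^ 2 + C + C) * (1 + ‖y‖) ^ (N + 1))) :=
        mul_le_mul_of_nonneg_left (mul_le_mul h1 h2 (abs_nonneg _) (by positivity))
          (gaussWeight_pos y).le
    _ = C * (C ^ 2 + C + C) * (1 + ‖y‖) ^ (N + 2) * gaussWeight y := by ring

end Summit.NavierStokesRegularity.NavierStokesRegularity.Theorems.GaussianHeadPressure

end
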